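import Literature.AlgebraicGeometry.Resolution.MonomialChartCentreUnits
import Literature.AlgebraicGeometry.Resolution.InvariantLatticeToricChart
import Mathlib.RingTheory.RegularLocalRing.Polynomial
import Mathlib.RingTheory.KrullDimension.Polynomial
import Mathlib.RingTheory.KrullDimension.Field
import Mathlib.RingTheory.Ideal.Height
import Mathlib.Algebra.Module.SpanRank
import Mathlib.RingTheory.Localization.AtPrime.Basic
import Mathlib.RingTheory.MvPolynomial.Basic
import HarnessLib

/-!
# Regularity of a monomial chart with unit parameters (the toric chart of the ring of invariants)

Topic: `Literature/AlgebraicGeometry/Resolution`. PROOF side of `CossartPiltant2019ReductionP`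
(`ArithmeticalThreefoldsLocal.lean`), eleventh brick of its one remaining input (C4) — descent of
local uniformization below the ramification field ([CoP1] Props. 9.3/9.5 with Lemma 9.4), on the
TORIC ROUTE (`InvariantLatticeToricChart.lean`, `MonomialChartCentreUnits.lean`): the REGULARITY
COUNT for the chart `T = A[y₁, …, y_d] ⊆ O` of a dominated local ring `A` whose maximal ideal is
generated by monomials in the `yᵢ` ([CoP1] proof of Lemma 9.4: "`S₁ := S̄_{𝔪_W ∩ S̄}` is a local
model of `W` and `S₁` is regular by (b)", HAL p. 29; Fulton §2.6: the charts `U_τ` of a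
nonsingular subdivision are affine spaces). With `y₊` the `yᵢ` of positive value and `y₀` the
units, `MonomialChartCentreUnits.lean` gives `𝔪_{T_𝔭} = (y₊) + (𝔪_O ∩ A[y₀])` and
`𝔪_A T ⊆ (y₊)`; so `κ(A)[Y₀] → T_𝔭/(y₊)` is defined, the kernel `Q` of
`κ(A)[Y₀] → κ(O)` is prime, `κ(A)[Y₀]_Q` is a regular local ring (Mathlib: polynomial rings over
a field are regular) of dimension `ht Q ≤ #y₀`, and the images of `≤ #y₀` generators of `Q_Q`
together with `y₊` generate `𝔪_{T_𝔭}`: at most `d` generators. Hence: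

* `isRegularLocalRing_locAtCentre_adjoin_monomials` — PROVED: if `dim T_𝔭 = d` (supplied by the
  dimension formula, `LocalModels.ringKrullDim_localization_centre_eq`, when `A` is universally
  catenary of dimension `d` and the residue field of `O` is algebraic over that of `A`), then
  `T_𝔭 = locAtCentre T O` is a regular local ring.
* `exists_toricChart_isRegularLocalRing_of_addSubgroup` — PROVED: the same for an arbitrary
  exponent lattice `N ⊇ ℓℤ^d` (diagonalisable abelian tame groups).
* `exists_toricChart_isRegularLocalRing` — PROVED, the `σ`-free core of the descent step of
  [CoP1] Lemma 9.4 assembled with `InvariantLatticeToricChart.lean`: for `𝔪_A` generated by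
  monomials `x^w`, `t·w ≡ 0 (mod ℓ)`, in non-zero `x₁, …, x_d ∈ O`, there are Laurent monomials
  `yᵢ = x^{nᵢ} ∈ O` with `ℓ ∣ t·nᵢ` (a `ℤ`-basis of the invariant exponents) such that
  `A[y]_{𝔪_O ∩ A[y]}` is regular as soon as it has dimension `d`.

Everything is PROVED; no named facts are introduced.

## Sources

* V. Cossart, O. Piltant, *Resolution of singularities of threefolds in positive characteristic.
  I*, J. Algebra 320 (2008) 1051–1082: proof of Lemma 9.4, (53)–(54) (HAL hal-00139124, p. 29).
  [CossartPiltant2008]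
* W. Fulton, *Introduction to Toric Varieties*, Ann. of Math. Studies 131 (1993): §2.1
  (nonsingular cones give affine spaces) and §2.6 (pp. 45–50). [Fulton1993Toric]
-/

noncomputable section

namespace Literature.AlgebraicGeometry.Resolution

universe u

open IsLocalRing

section Regularity

variable {E : Type u} [Field E] (O : ValuationSubring E)

/-- `A[y₁, …, y_d]` inside `E` is the subalgebra generated by the finite family `y`, hence
Noetherian when `A` is. [folklore] -/
private theorem isNoetherianRing_closure_union_range (A : Subring E) [IsNoetherianRing A] {d : ℕ}
    (y : Fin d → E) : IsNoetherianRing (Subring.closure ((A : Set E) ∪ Set.range y)) := by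
  classical
  have e : Subring.closure ((A : Set E) ∪ Set.range y) =
      (Algebra.adjoin A ((Finset.univ.image y : Finset E) : Set E)).toSubring := by
    rw [Algebra.adjoin_eq_ring_closure]
    congr 1
    ext z
    simp only [Set.mem_union, SetLike.mem_coe, Set.mem_range, Finset.coe_image, Finset.coe_univ,
      Set.image_univ]
    constructor
    · rintro (hz | hz)
      · exact Or.inl ⟨⟨z, hz⟩, rfl⟩
      · exact Or.inr hz
    · rintro (⟨w, rfl⟩ | hz)
      · exact Or.inl w.2
      · exact Or.inr hz
  rw [e]
  exact isNoetherianRing_of_fg (Subalgebra.fg_adjoin_finset _)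

/-- **The monomial chart with unit parameters is regular** ([CoP1] proof of Lemma 9.4: "`S₁` is
regular by (b)", HAL p. 29 — here for the toric chart of the ring of invariants, in every
dimension). Let `O` be a valuation ring of a field `E`, `A ⊆ O` a Noetherian local subring
dominated by `O` whose maximal ideal is generated by a set `G` of monomials `∏ yᵢ^{cᵢ}` in
`y₁, …, y_d ∈ O`, and `T := A[y₁, …, y_d]`. If the local ring `T_𝔭 = locAtCentre T O` at the
centre of `O` has dimension `d`, it is a regular local ring: by `MonomialChartCentreUnits.lean`
its maximal ideal is `(yᵢ : v(yᵢ) < 1) + (𝔪_O ∩ A[yᵢ : v(yᵢ) = 1])`, and the second summand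
needs, modulo the first, at most `#{i : v(yᵢ) = 1}` generators, the images of generators of the
maximal ideal of the regular local ring `κ(A)[Yᵢ : v(yᵢ) = 1]_Q`, `Q` the kernel of
`Yᵢ ↦ ȳᵢ ∈ κ(O)` (Mathlib `MvPolynomial.isRegularRing_of_isRegularRing`, `ht Q ≤ #Y`).
[cite: CossartPiltant2008, proof of Lemma 9.4, (53)–(54) and "S₁ is regular by (b)" (HAL p. 29)]
[cite: Fulton1993Toric, Section 2.6 (pp. 45–50)] -/
theorem isRegularLocalRing_locAtCentre_adjoin_monomials (A : Subring E) [IsLocalRing A]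
    [IsNoetherianRing A] (hAO : A ≤ O.toSubring)
    (hdom : ∀ a : A, a ∈ maximalIdeal A ↔ O.valuation (a : E) < 1)
    {d : ℕ} (y : Fin d → E) (hyO : ∀ i, y i ∈ O)
    (G : Set A) (hG : Ideal.span G = maximalIdeal A)
    (hGmon : ∀ g ∈ G, ∃ c : Fin d → ℕ, ((g : A) : E) = ∏ i, y i ^ c i)
    (hdim : ringKrullDim (locAtCentre (Subring.closure ((A : Set E) ∪ Set.range y)) O) = d) :
    IsRegularLocalRing (locAtCentre (Subring.closure ((A : Set E) ∪ Set.range y)) O) := by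
  classical
  set T := Subring.closure ((A : Set E) ∪ Set.range y) with hT
  have hTO : T ≤ O.toSubring := Subring.closure_le.mpr (Set.union_subset hAO (by
    rintro _ ⟨i, rfl⟩; exact hyO i))
  have hAT : A ≤ T := fun a ha => Subring.subset_closure (Set.mem_union_left _ ha)
  have hyT : ∀ i, y i ∈ T := fun i => Subring.subset_closure (Set.mem_union_right _ ⟨i, rfl⟩)
  set R := locAtCentre T O with hR
  have hRO : R ≤ O.toSubring := locAtCentre_le hTO
  have hTR : T ≤ R := le_locAtCentre T O
  have hAR : A ≤ R := hAT.trans hTR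
  haveI : IsLocalRing R := isLocalRing_locAtCentre hTO
  haveI : IsNoetherianRing T := isNoetherianRing_closure_union_range A y
  haveI : IsNoetherianRing R :=
    isNoetherianRing_of_ringEquiv (R := Localization.AtPrime (subringCentre T O hTO))
      (locAtCentreEquiv hTO).toRingEquiv
  have hmemR : ∀ x : R, x ∈ maximalIdeal R ↔ O.valuation (x : E) < 1 :=
    mem_maximalIdeal_locAtCentre_iff hTO
  have hvalR : ∀ x : R, O.valuation (x : E) ≤ 1 := fun x => (O.valuation_le_one_iff _).mpr (hRO x.2)
  have hunitR : ∀ x : R, O.valuation (x : E) = 1 → IsUnit x := fun x hx => by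
    by_contra hnu
    have h := (not_isUnit_locAtCentre_iff hTO x).mp hnu
    rw [hx] at h
    exact lt_irrefl _ h
  -- the new parameters in `R`, split into units (`ι₀`) and elements of positive value (`ιp`)
  let yR : Fin d → R := fun i => ⟨y i, hTR (hyT i)⟩
  have hyR : ∀ i, ((yR i : R) : E) = y i := fun i => rfl
  let ι₀ := {i : Fin d // O.valuation (y i) = 1}
  let ιp := {i : Fin d // ¬ O.valuation (y i) = 1}
  have hcard : Fintype.card ιp + Fintype.card ι₀ = d := by
    have h := Fintype.card_subtype_compl (fun i : Fin d => O.valuation (y i) = 1)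
    have hle : Fintype.card ι₀ ≤ d := by
      calc Fintype.card ι₀ ≤ Fintype.card (Fin d) := Fintype.card_subtype_le _
        _ = d := Fintype.card_fin d
    change Fintype.card ιp = Fintype.card (Fin d) - Fintype.card ι₀ at h
    rw [Fintype.card_fin] at h
    omega
  have hypos : ∀ i : ιp, O.valuation (y i.1) < 1 := fun i =>
    lt_of_le_of_ne ((O.valuation_le_one_iff _).mpr (hyO i.1)) i.2
  -- the ideal `J = (yᵢ : v(yᵢ) < 1)` of `R`; it lies in `𝔪_R`
  let J : Ideal R := Ideal.span (Set.range fun i : ιp => yR i.1)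
  have hJle : J ≤ maximalIdeal R := by
    refine Ideal.span_le.mpr ?_
    rintro _ ⟨i, rfl⟩
    exact (hmemR _).mpr (hypos i)
  have hJsum : ∀ (x : R) (r : Fin d → E), (∀ i, r i ∈ R) → (∀ i, O.valuation (y i) = 1 → r i = 0) →
      (x : E) = ∑ i, r i * y i → x ∈ J := by
    intro x r hr hr0 hx
    have hx' : x = ∑ i, (⟨r i, hr i⟩ : R) * yR i := Subtype.ext (by
      rw [hx, AddSubmonoidClass.coe_finsetSum]; rfl)
    rw [hx']
    refine Ideal.sum_mem _ fun i _ => ?_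
    by_cases hi : O.valuation (y i) = 1
    · have : (⟨r i, hr i⟩ : R) = 0 := Subtype.ext (hr0 i hi)
      rw [this, zero_mul]; exact J.zero_mem
    · exact Ideal.mul_mem_left _ _ (Ideal.subset_span ⟨⟨i, hi⟩, rfl⟩)
  -- `𝔪_A ⊆ J` (the monomial hypothesis, `exists_sum_mul_pos_of_mem_maximalIdeal`)
  let ιR : A →+* R := Subring.inclusion hAR
  have hιR : ∀ a : A, ((ιR a : R) : E) = a := fun a => rfl
  have hmAJ : ∀ a ∈ maximalIdeal A, ιR a ∈ J := fun a ha => by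
    obtain ⟨r, hr, hr0, hsum⟩ := exists_sum_mul_pos_of_mem_maximalIdeal O A hdom y hyO G hG hGmon ha
    exact hJsum (ιR a) r (fun i => hTR (hr i)) hr0 hsum
  -- polynomial rings in the unit variables, and their evaluations
  let k := ResidueField A
  let ιO : A →+* O := Subring.inclusion hAO
  have hιO : ∀ a : A, ((ιO a : O) : E) = a := fun a => rfl
  let yO : ι₀ → O := fun i => ⟨y i.1, hyO i.1⟩
  let evE : MvPolynomial ι₀ A →+* E := MvPolynomial.eval₂Hom A.subtype fun i => y i.1
  let evR : MvPolynomial ι₀ A →+* R := MvPolynomial.eval₂Hom ιR fun i => yR i.1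
  let evO : MvPolynomial ι₀ A →+* O := MvPolynomial.eval₂Hom ιO yO
  have hevR : ∀ P, ((evR P : R) : E) = evE P := fun P => by
    change R.subtype (MvPolynomial.eval₂Hom ιR (fun i => yR i.1) P) = _
    rw [MvPolynomial.map_eval₂Hom]
    rfl
  have hevO : ∀ P, ((evO P : O) : E) = evE P := fun P => by
    change O.subtype (MvPolynomial.eval₂Hom ιO yO P) = _
    rw [MvPolynomial.map_eval₂Hom]
    rfl
  -- `T₀ = A[y₀]` is contained in the image of `A[Y₀]`
  have hT₀ : ∀ q ∈ Subring.closure ((A : Set E) ∪ Set.range (fun i : ι₀ => y i.1)),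
      ∃ P : MvPolynomial ι₀ A, evE P = q := by
    intro q hq
    have hle : Subring.closure ((A : Set E) ∪ Set.range (fun i : ι₀ => y i.1)) ≤ evE.range := by
      refine Subring.closure_le.mpr (Set.union_subset ?_ ?_)
      · intro a ha
        exact ⟨MvPolynomial.C ⟨a, ha⟩, by simp [evE]⟩
      · rintro _ ⟨i, rfl⟩
        exact ⟨MvPolynomial.X i, by simp [evE]⟩
    obtain ⟨P, hP⟩ := hle hq
    exact ⟨P, hP⟩
  -- the residue map `ψ : k[Y₀] → κ(O)` and the chart map `θ : k[Y₀] → R/J`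
  have hψ₀ : ∀ a ∈ maximalIdeal A, ((residue O).comp ιO) a = 0 := fun a ha => by
    rw [RingHom.comp_apply, residue_eq_zero_iff, ValuationSubring.valuation_lt_one_iff]
    exact (hdom a).mp ha
  let ψ₀ : k →+* ResidueField O := Ideal.Quotient.lift (maximalIdeal A) ((residue O).comp ιO) hψ₀
  have hψ₀res : ψ₀.comp (residue A) = (residue O).comp ιO :=
    RingHom.ext fun a => by
      rw [RingHom.comp_apply]
      exact Ideal.Quotient.lift_mk (maximalIdeal A) _ _
  let ψ : MvPolynomial ι₀ k →+* ResidueField O :=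
    MvPolynomial.eval₂Hom ψ₀ fun i => residue O (yO i)
  have hψ : ∀ P : MvPolynomial ι₀ A, ψ (MvPolynomial.map (residue A) P) = residue O (evO P) :=
    fun P => by
    change MvPolynomial.eval₂Hom ψ₀ (fun i => residue O (yO i)) (MvPolynomial.map (residue A) P) =
      residue O (MvPolynomial.eval₂Hom ιO yO P)
    rw [MvPolynomial.eval₂Hom_map_hom, hψ₀res, MvPolynomial.map_eval₂Hom]
  have hθ₀ : ∀ a ∈ maximalIdeal A, ((Ideal.Quotient.mk J).comp ιR) a = 0 := fun a ha => by
    rw [RingHom.comp_apply, Ideal.Quotient.eq_zero_iff_mem]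
    exact hmAJ a ha
  let θ₀ : k →+* R ⧸ J := Ideal.Quotient.lift (maximalIdeal A) ((Ideal.Quotient.mk J).comp ιR) hθ₀
  have hθ₀res : θ₀.comp (residue A) = (Ideal.Quotient.mk J).comp ιR :=
    RingHom.ext fun a => by
      rw [RingHom.comp_apply]
      exact Ideal.Quotient.lift_mk (maximalIdeal A) _ _
  let θ : MvPolynomial ι₀ k →+* R ⧸ J :=
    MvPolynomial.eval₂Hom θ₀ fun i => Ideal.Quotient.mk J (yR i.1)
  have hθ : ∀ P : MvPolynomial ι₀ A,
      θ (MvPolynomial.map (residue A) P) = Ideal.Quotient.mk J (evR P) := fun P => by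
    change MvPolynomial.eval₂Hom θ₀ (fun i => Ideal.Quotient.mk J (yR i.1))
        (MvPolynomial.map (residue A) P) = Ideal.Quotient.mk J (MvPolynomial.eval₂Hom ιR _ P)
    rw [MvPolynomial.eval₂Hom_map_hom, hθ₀res, MvPolynomial.map_eval₂Hom]
  have hmapsurj : Function.Surjective (MvPolynomial.map (σ := ι₀) (residue A)) :=
    MvPolynomial.map_surjective _ residue_surjective
  -- the prime `Q = ker ψ`; its localization is regular of dimension `≤ #ι₀`
  let Q : Ideal (MvPolynomial ι₀ k) := RingHom.ker ψ
  haveI hQ : Q.IsPrime := RingHom.ker_isPrime ψ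
  let L := Localization.AtPrime Q
  haveI : IsRegularLocalRing L := inferInstance
  have hLfg : (maximalIdeal L).FG := IsNoetherian.noetherian _
  obtain ⟨sQ, hsQcard, hsQspan⟩ := Submodule.FG.exists_span_finset_card_eq_spanFinrank hLfg
  have hsQle : sQ.card ≤ Fintype.card ι₀ := by
    have h1 : ((maximalIdeal L).spanFinrank : WithBot ℕ∞) = ringKrullDim L :=
      IsRegularLocalRing.spanFinrank_maximalIdeal
    have h2 : ringKrullDim L = Q.height := IsLocalization.AtPrime.ringKrullDim_eq_height Q L
    have h3 : (Q.height : WithBot ℕ∞) ≤ ringKrullDim (MvPolynomial ι₀ k) :=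
      Ideal.height_le_ringKrullDim_of_isPrime
    have h4 : ringKrullDim (MvPolynomial ι₀ k) = (Fintype.card ι₀ : WithBot ℕ∞) := by
      rw [MvPolynomial.ringKrullDim_of_isNoetherianRing, ringKrullDim_eq_zero_of_field k, zero_add,
        Nat.card_eq_fintype_card]
    have h5 : ((sQ.card : ℕ∞) : WithBot ℕ∞) ≤ ((Fintype.card ι₀ : ℕ∞) : WithBot ℕ∞) := by
      have h := h1
      rw [hsQcard.symm, h2] at h
      rw [WithBot.coe_natCast, WithBot.coe_natCast, h]
      exact h3.trans h4.le
    exact_mod_cast (WithBot.coe_le_coe.mp h5)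
  -- `θ` inverts `Q.primeCompl`, so it extends to `Λ : L → R/J`
  have hθunit : ∀ s : Q.primeCompl, IsUnit (θ s) := by
    intro s
    obtain ⟨P, hP⟩ := hmapsurj (s : MvPolynomial ι₀ k)
    have hsQ : ψ s ≠ 0 := fun h => s.2 (by simpa [Q, RingHom.mem_ker] using h)
    rw [← hP, hψ, residue_ne_zero_iff_isUnit, ValuationSubring.valuation_eq_one_iff, hevO] at hsQ
    rw [← hP, hθ]
    refine (hunitR (evR P) ?_).map _
    rw [hevR]; exact hsQ
  let Λ : L →+* R ⧸ J := IsLocalization.lift (M := Q.primeCompl) hθunit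
  have hΛ : ∀ P : MvPolynomial ι₀ k, Λ (algebraMap _ L P) = θ P := fun P =>
    IsLocalization.lift_eq hθunit P
  -- `ψ P = 0` means the evaluation has positive value, i.e. lies in `𝔪_R`
  have hkerval : ∀ P : MvPolynomial ι₀ A, MvPolynomial.map (residue A) P ∈ Q ↔
      O.valuation (evE P) < 1 := fun P => by
    rw [RingHom.mem_ker, hψ, residue_eq_zero_iff, ValuationSubring.valuation_lt_one_iff, hevO]
  -- lifts to `R` of the images of the generators of `𝔪_L`
  let lift : R ⧸ J → R := Function.surjInv Ideal.Quotient.mk_surjective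
  have hlift : ∀ w, Ideal.Quotient.mk J (lift w) = w := Function.surjInv_eq _
  -- `Λ` is local: a lift of `Λ g`, `g ∈ 𝔪_L`, is not a unit
  have hΛloc : ∀ g ∈ maximalIdeal L, ∀ r : R, Ideal.Quotient.mk J r = Λ g → r ∈ maximalIdeal R := by
    intro g hg r hr
    obtain ⟨⟨x, s⟩, hxs⟩ := IsLocalization.surj Q.primeCompl g
    -- `x ∈ Q` since `g ∈ 𝔪_L`
    have hxQ : x ∈ Q := by
      have h1 : algebraMap _ L x ∈ maximalIdeal L := by
        rw [← hxs]; exact Ideal.mul_mem_right _ _ hg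
      exact (IsLocalization.AtPrime.to_map_mem_maximal_iff L Q x).mp h1
    obtain ⟨P, hP⟩ := hmapsurj x
    have hPval : O.valuation (evE P) < 1 := (hkerval P).mp (hP ▸ hxQ)
    have hPm : evR P ∈ maximalIdeal R := (hmemR _).mpr (by rw [hevR]; exact hPval)
    -- `mk r * θ s = θ x = mk (evR P)`
    have hprod : Ideal.Quotient.mk J r * θ s = Ideal.Quotient.mk J (evR P) := by
      rw [hr, ← hΛ, ← map_mul, hxs, hΛ, ← hP, hθ]
    by_contra hru
    have hu : IsUnit (Ideal.Quotient.mk J (evR P)) := by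
      rw [← hprod]
      exact ((IsLocalRing.notMem_maximalIdeal.mp hru).map _).mul (hθunit s)
    obtain ⟨w, hw⟩ := hu.exists_right_inv
    obtain ⟨w', rfl⟩ := Ideal.Quotient.mk_surjective w
    rw [← map_mul, ← map_one (Ideal.Quotient.mk J), Ideal.Quotient.eq] at hw
    have h1 : (1 : R) ∈ maximalIdeal R := by
      have : (1 : R) = evR P * w' - (evR P * w' - 1) := by ring
      rw [this]
      exact Ideal.sub_mem _ (Ideal.mul_mem_right _ _ hPm) (hJle hw)
    exact (maximalIdeal.isMaximal R).ne_top (Ideal.eq_top_of_isUnit_mem _ h1 isUnit_one)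
  -- the generating set: `y₊` and the lifts of `Λ(sQ)`
  let G₁ : Finset R := Finset.univ.image fun i : ιp => yR i.1
  let G₂ : Finset R := sQ.image fun g => lift (Λ g)
  have hsQmem : ∀ g ∈ sQ, g ∈ maximalIdeal L := fun g hg => by
    rw [← hsQspan]; exact Submodule.subset_span hg
  have hG₂m : ∀ r ∈ G₂, r ∈ maximalIdeal R := by
    intro r hr
    obtain ⟨g, hg, rfl⟩ := Finset.mem_image.mp hr
    exact hΛloc g (hsQmem g hg) _ (hlift _)
  have hJG : J ≤ Ideal.span ((G₁ ∪ G₂ : Finset R) : Set R) := by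
    refine Ideal.span_le.mpr ?_
    rintro _ ⟨i, rfl⟩
    exact Ideal.subset_span (by simp [G₁])
  -- `𝔪_O ∩ T₀ ⊆ (G₂) + J`
  have hT₀mem : ∀ q ∈ Subring.closure ((A : Set E) ∪ Set.range (fun i : ι₀ => y i.1)),
      ∀ hq : q ∈ R, O.valuation q < 1 → (⟨q, hq⟩ : R) ∈ Ideal.span (G₂ : Set R) ⊔ J := by
    intro q hqT₀ hqR hqv
    obtain ⟨P, hP⟩ := hT₀ q hqT₀
    have hPq : evR P = ⟨q, hqR⟩ := Subtype.ext (by rw [hevR, hP])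
    have hPQ : MvPolynomial.map (residue A) P ∈ Q := (hkerval P).mpr (hP ▸ hqv)
    have hL : algebraMap _ L (MvPolynomial.map (residue A) P) ∈ maximalIdeal L :=
      (IsLocalization.AtPrime.to_map_mem_maximal_iff L Q _).mpr hPQ
    rw [← hsQspan] at hL
    have hΛmem : Λ (algebraMap _ L (MvPolynomial.map (residue A) P)) ∈
        (Ideal.span (G₂ : Set R)).map (Ideal.Quotient.mk J) := by
      have h1 : Λ (algebraMap _ L (MvPolynomial.map (residue A) P)) ∈
          (Ideal.span (sQ : Set L)).map Λ := Ideal.mem_map_of_mem _ hL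
      rw [Ideal.map_span] at h1
      rw [Ideal.map_span]
      refine (Ideal.span_mono ?_) h1
      rintro _ ⟨g, hg, rfl⟩
      exact ⟨lift (Λ g), Finset.mem_image_of_mem _ hg, hlift _⟩
    rw [hΛ, hθ, hPq] at hΛmem
    exact Ideal.mem_quotient_iff_mem_sup.mp hΛmem
  -- `𝔪_R = (G₁ ∪ G₂)`
  have hmax : maximalIdeal R = Ideal.span ((G₁ ∪ G₂ : Finset R) : Set R) := by
    apply le_antisymm
    · intro x hx
      have hxv : O.valuation (x : E) < 1 := (hmemR x).mp hx
      obtain ⟨r, hr, hr0, q, hq, hqv, g, hg, hgv, hxeq⟩ :=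
        exists_decomp_of_mem_maximalIdeal_locAtCentre O A hAO y hyO x.2 hxv
      have hg0 : g ≠ 0 := ne_zero_of_valuation_eq_one hgv
      have hqR : q ∈ R := hTR ((Subring.closure_le.mpr (Set.union_subset
        (fun a ha => Subring.subset_closure (Set.mem_union_left _ ha))
        (by rintro _ ⟨i, rfl⟩; exact hyT i.1)) : _ ≤ T) hq)
      have hginvR : g⁻¹ ∈ R := inv_mem_locAtCentre (hTR hg) hgv
      -- `x = (∑ rᵢ yᵢ) + q · g⁻¹` in `R`
      let x₁ : R := ⟨∑ i, r i * y i, by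
        refine Subring.sum_mem _ fun i _ => Subring.mul_mem _ (hr i) (hTR (hyT i))⟩
      have hx₁J : x₁ ∈ J := hJsum x₁ r hr hr0 rfl
      have hxdecomp : x = x₁ + ⟨q, hqR⟩ * ⟨g⁻¹, hginvR⟩ := Subtype.ext (by
        change (x : E) = (∑ i, r i * y i) + q * g⁻¹
        rw [hxeq, div_eq_mul_inv])
      rw [hxdecomp]
      refine Ideal.add_mem _ (hJG hx₁J) (Ideal.mul_mem_right _ _ ?_)
      have h := hT₀mem q hq hqR hqv
      refine (sup_le ?_ hJG) h
      exact Ideal.span_mono (by simp)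
    · refine Ideal.span_le.mpr fun r hr => ?_
      rcases Finset.mem_union.mp (Finset.mem_coe.mp hr) with hr | hr
      · obtain ⟨i, -, rfl⟩ := Finset.mem_image.mp hr
        exact (hmemR _).mpr (hypos i)
      · exact hG₂m r hr
  -- count generators
  have hcount : (maximalIdeal R).spanFinrank ≤ d := by
    rw [hmax]
    calc (Ideal.span ((G₁ ∪ G₂ : Finset R) : Set R)).spanFinrank
        ≤ ((G₁ ∪ G₂ : Finset R) : Set R).ncard :=
          Submodule.spanFinrank_span_le_ncard_of_finite (Finset.finite_toSet _)
      _ = (G₁ ∪ G₂).card := Set.ncard_coe_finset _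
      _ ≤ G₁.card + G₂.card := Finset.card_union_le _ _
      _ ≤ Fintype.card ιp + sQ.card := by
          gcongr
          · exact Finset.card_image_le.trans (by rw [Finset.card_univ])
          · exact Finset.card_image_le
      _ ≤ Fintype.card ιp + Fintype.card ι₀ := by gcongr
      _ = d := hcard
  refine IsRegularLocalRing.of_spanFinrank_maximalIdeal_le R ?_
  rw [hdim]
  exact_mod_cast hcount

/-- **The regular toric chart** ([CoP1] proof of Lemma 9.4, (53)–(54) and "`S₁` … is a local
model of `W` and `S₁` is regular by (b)", HAL p. 29; toric form, every dimension). Let `O` be a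
valuation ring of a field `E`, `A ⊆ O` a Noetherian local subring dominated by `O`, `ℓ ≥ 1`,
`t : Fin d → ℕ` characters and `x₁, …, x_d ∈ O` non-zero such that `𝔪_A` is generated by a set
`G` of monomials `x^w` with `∑ tⱼ wⱼ ≡ 0 (mod ℓ)`. Then there are exponent vectors
`n₁, …, n_d ∈ ℤ^d` with `ℓ ∣ ∑ⱼ tⱼ nᵢⱼ` (so the `yᵢ := ∏ⱼ xⱼ^{nᵢⱼ}` are invariant under
`xⱼ ↦ ζ^{tⱼ} xⱼ`), `yᵢ ∈ O`, the `nᵢ` a `ℤ`-basis of the invariant exponents, and such that the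
local ring `A[y]_{𝔪_O ∩ A[y]} = locAtCentre A[y] O` is REGULAR provided it has dimension `d`.
[cite: CossartPiltant2008, proof of Lemma 9.4, (53)–(54) (HAL p. 29)]
[cite: Fulton1993Toric, Section 2.6 (pp. 45–50)] -/
theorem exists_toricChart_isRegularLocalRing (A : Subring E) [IsLocalRing A] [IsNoetherianRing A]
    (hAO : A ≤ O.toSubring) (hdom : ∀ a : A, a ∈ maximalIdeal A ↔ O.valuation (a : E) < 1)
    {d ℓ : ℕ} (hℓ : 0 < ℓ) (t : Fin d → ℕ) (x : Fin d → E) (hx0 : ∀ j, x j ≠ 0)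
    (hxO : ∀ j, x j ∈ O) (G : Set A) (hG : Ideal.span G = maximalIdeal A)
    (hGmon : ∀ g ∈ G, ∃ w : Fin d → ℕ, (∑ j, t j * w j) % ℓ = 0 ∧ ((g : A) : E) = ∏ j, x j ^ w j) :
    ∃ n : Fin d → (Fin d → ℤ),
      (∀ i, (ℓ : ℤ) ∣ ∑ j, (t j : ℤ) * n i j) ∧
      (∀ i, (∏ j, x j ^ n i j) ∈ O) ∧
      (∀ h : Fin d → ℤ, (ℓ : ℤ) ∣ ∑ j, (t j : ℤ) * h j → ∃! c : Fin d → ℤ, h = ∑ i, c i • n i) ∧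
      (ringKrullDim (locAtCentre (Subring.closure ((A : Set E) ∪
          Set.range fun i => ∏ j, x j ^ n i j)) O) = d →
        IsRegularLocalRing (locAtCentre (Subring.closure ((A : Set E) ∪
          Set.range fun i => ∏ j, x j ^ n i j)) O)) := by
  obtain ⟨n, hdvd, hO, hmon, huniq⟩ := exists_invariant_toricChart O hℓ t x hx0 hxO
  refine ⟨n, hdvd, hO, huniq, fun hdim => ?_⟩
  refine isRegularLocalRing_locAtCentre_adjoin_monomials O A hAO hdom
    (fun i => ∏ j, x j ^ n i j) hO G hG (fun g hg => ?_) hdim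
  obtain ⟨w, hw, hgw⟩ := hGmon g hg
  obtain ⟨c, hc⟩ := hmon w hw
  exact ⟨c, by rw [hgw, hc]⟩

/-- **The regular toric chart for an arbitrary lattice of invariant exponents** — the variant
of `exists_toricChart_isRegularLocalRing` for a diagonalisable ABELIAN tame group (the exponent-`ℓ`
Galois groups of Kummer coverings): `𝔪_A` generated by monomials `x^w` with exponents `w` in a
subgroup `N ⊇ ℓℤ^d` of `ℤ^d`; then there are Laurent monomials `yᵢ = x^{nᵢ} ∈ O`, `nᵢ ∈ N` a
`ℤ`-basis of `N`, such that `A[y]_{𝔪_O ∩ A[y]}` is regular as soon as it has dimension `d`.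
[cite: CossartPiltant2008, proof of Lemma 9.4, (53)–(54) (HAL p. 29)]
[cite: Fulton1993Toric, Section 2.6 (pp. 45–50)] -/
theorem exists_toricChart_isRegularLocalRing_of_addSubgroup (A : Subring E) [IsLocalRing A]
    [IsNoetherianRing A] (hAO : A ≤ O.toSubring)
    (hdom : ∀ a : A, a ∈ maximalIdeal A ↔ O.valuation (a : E) < 1)
    {d ℓ : ℕ} (hℓ : 0 < ℓ) (N : AddSubgroup (Fin d → ℤ)) (hN : ∀ v : Fin d → ℤ, ℓ • v ∈ N)
    (x : Fin d → E) (hx0 : ∀ j, x j ≠ 0) (hxO : ∀ j, x j ∈ O) (G : Set A)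
    (hG : Ideal.span G = maximalIdeal A)
    (hGmon : ∀ g ∈ G, ∃ w : Fin d → ℕ, (fun j => (w j : ℤ)) ∈ N ∧ ((g : A) : E) = ∏ j, x j ^ w j) :
    ∃ n : Fin d → (Fin d → ℤ),
      (∀ i, n i ∈ N) ∧
      (∀ i, (∏ j, x j ^ n i j) ∈ O) ∧
      (∀ h ∈ N, ∃! c : Fin d → ℤ, h = ∑ i, c i • n i) ∧
      (ringKrullDim (locAtCentre (Subring.closure ((A : Set E) ∪
          Set.range fun i => ∏ j, x j ^ n i j)) O) = d →
        IsRegularLocalRing (locAtCentre (Subring.closure ((A : Set E) ∪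
          Set.range fun i => ∏ j, x j ^ n i j)) O)) := by
  obtain ⟨n, hnN, hO, hmon, huniq⟩ := exists_toricChart_of_addSubgroup O hℓ N hN x hx0 hxO
  refine ⟨n, hnN, hO, huniq, fun hdim => ?_⟩
  refine isRegularLocalRing_locAtCentre_adjoin_monomials O A hAO hdom
    (fun i => ∏ j, x j ^ n i j) hO G hG (fun g hg => ?_) hdim
  obtain ⟨w, hw, hgw⟩ := hGmon g hg
  obtain ⟨c, hc⟩ := hmon w hw
  exact ⟨c, by rw [hgw, hc]⟩

end Regularity

end Literature.AlgebraicGeometry.Resolution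

end
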